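import Literature.AlgebraicGeometry.Resolution.ExceptionalDivisorLocallyTrivialHolds
import HarnessLib

/-!
# The exceptional divisor of the blowing up of a smooth projective variety along a smooth closed
# subvariety is a Zariski-locally trivial `ℙʳ`-bundle over the centre (Hartshorne II 8.24 (b))

Route `BoundaryReadout` / `QbarEnvelope` of `HodgeConjecture`, crux `PullbackAlgebraic`
(stmt-HodgeConjecture-1071), line `normal_cone`, stub `stub_exceptionalDivisorLocallyTrivial`:
the named fact `Resolution.Hartshorne1977_exceptionalDivisor_locallyTrivial` at universe `0`. It is
now a THEOREM of the tree (`Resolution.Hartshorne1977_exceptionalDivisor_locallyTrivial_holds`,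
`Literature/AlgebraicGeometry/Resolution/ExceptionalDivisorLocallyTrivialHolds.lean`, universe
polymorphic): for a closed immersion `i : Z ⟶ V` of smooth projective varieties over a field `k`
(`dim V = dim Z + r + 1`) and ANY blowing up `β : B ⟶ V` along `ker i`, every point of `Z` has an
open neighbourhood `U` over which the exceptional divisor `E = B ×_V Z → Z` is isomorphic over `U`
to `U × ℙʳ_k → U`. The proof (all in `Literature/AlgebraicGeometry/Resolution`): locally on `V` the
ideal of `Z` is generated by a quasi-regular sequence of length `r + 1`
(`RegularCentreLocalCodim`: `ht 𝔭_{i z} = ht 𝔭_z + (r + 1)` at closed points); over such an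
affine open the blowing up is `Proj` of the Rees algebra (uniqueness of blowing ups), a graded
quotient of `L[T₀, …, T_r]` (`ExceptionalDivisorProjCharts`); and the exceptional divisor is the
fibre product of the centre with `ℙʳ` (`ExceptionalDivisorProjectiveBundle`: chartwise the
kernel of `(L[T]_{T_i})₀ → (L[It]_{(x_i t)})₀ ⧸ I` is `I · (L[T]_{T_i})₀` by quasi-regularity).

## References

* [Hartshorne1977] R. Hartshorne, Algebraic Geometry, GTM 52 (1977), II Thm. 8.24 (b), II Thm. 8.17.
* [Liu2002] Q. Liu, Algebraic Geometry and Arithmetic Curves (2002), Thm. 8.1.19 (b).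
* [Fulton1998] W. Fulton, Intersection Theory, 2nd ed. (1998), App. B.6.9, B.7.1.
-/

noncomputable section

-- `Summit.HodgeConjecture.HodgeConjecture.…` is the mandated namespace (single-conjunct summit).
set_option linter.dupNamespace false

namespace Summit.HodgeConjecture.HodgeConjecture.Theorems.PullbackAlgebraicNormalCone

open CategoryTheory CategoryTheory.Limits AlgebraicGeometry MonoidalCategory CartesianMonoidalCategory
open Literature.AlgebraicGeometry Literature.AlgebraicGeometry.Motives Literature.AlgebraicGeometry.Resolution

/-- **Stub A of line `normal_cone` — Hartshorne II Thm. 8.24 (b) (with II 8.17; Liu 8.1.19 (b);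
Fulton B.6.9): the exceptional divisor of the blowing up of a smooth projective variety along a
smooth closed subvariety is a Zariski-locally trivial `ℙʳ`-bundle over the centre**, i.e. the
named fact `Resolution.Hartshorne1977_exceptionalDivisor_locallyTrivial` at universe `0`, now
discharged by the theorem `Resolution.Hartshorne1977_exceptionalDivisor_locallyTrivial_holds`.
[cite: Hartshorne1977, II Thm. 8.24 (b) and II Thm. 8.17] [cite: Liu2002, Thm. 8.1.19 (b)] -/
theorem stub_exceptionalDivisorLocallyTrivial :
    Hartshorne1977_exceptionalDivisor_locallyTrivial.{0} :=
  Hartshorne1977_exceptionalDivisor_locallyTrivial_holds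

end Summit.HodgeConjecture.HodgeConjecture.Theorems.PullbackAlgebraicNormalCone

end
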